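import Summits.ABC.IUTFork.Thm311RealInd1StripOrbitSpan
import HarnessLib

/-!
# [IUTchIII] Thm 3.11 (i) (Ind1) at `v ∈ 𝕍^non`: the Jannsen–Wingberg log-basis is a BOX basis of `log_p(𝒪_v^×)` — INTEGRALITY of the realised
# planes (modulo `JannsenWingbergTwists`), and the CANONICAL orbit-span sandwich for regions with full plane contents

PROOF-ONLY file (abc-iut cell, Cor. 3.12 sub-crew, seat abc-iut-c312-1 = holder of record of the typed [IUTchIII] Thm. 3.11, gen 14; row
«R17 = C:PERIMAGE-PRINT-IND1», part d — the integrality brick named in R17b's census, obtained WITHOUT re-deriving the Jannsen–Wingberg basis: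
it follows from R17b §2 applied to the log-lattice itself).  TAKES NO SIDE on [IUTchIII] Cor. 3.12.

R15a (`Real.exists_realised_basis_trace_of_jannsenWingberg_odd`) gives the Jannsen–Wingberg `ℚ_p`-basis `y` of `K_v^{(1/n_v)}` only as a VECTOR-SPACE
basis; where its vectors sit relative to the lattice `L := log_p(𝒪_v^×)` was not exposed.  But the realised plane transvections lie in print's (Ind1) strip part,
which maps `L` onto itself (R9; R17b `sub_mem_smul_logUnits_inter_ker_trace_of_mem_ind1StripOf`), so R17b §2 with `M = N = L` gives, for every `z ∈ L`:
`y^*_{(i,ε)}(z)·y_{(i,ε')} ∈ L` for all planes `i` and `ε, ε'` — and then also `y^*_{inl 0}(z)·y_{inl 0} = z − Σ_{planes} ∈ L`.  That is: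

* §1 **`exists_boxBasis_logUnits_of_jannsenWingberg_odd`** (ODD `[K_v:ℚ_p] ≥ 3`, modulo `JannsenWingbergTwists`) — `L = log_p(𝒪_v^×)` is a BOX in the
  Jannsen–Wingberg basis: `L = J_0·y_{inl 0} ⊕ ⊕_i I_i·(ℤ_p y_{(i,0)} ⊕ ℤ_p y_{(i,1)})`, where `J_0 = y^*_{inl 0}(L)`, `I_i = y^*_{(i,0)}(L) = y^*_{(i,1)}(L)` (the two
  plane coordinates have the SAME value module — coordinate swap), stated coordinatewise: every coordinate projection of `z ∈ L` times the (swapped) basis vector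
  lies in `L`.  So, up to rescaling each basis vector by its content, the Jannsen–Wingberg log-basis IS a `ℤ_p`-basis of `log_p(𝒪_v^×)`, and
  `W_v := L ∩ Ker Tr = ⊕_i I_i·P_i` (the planes span `Ker Tr`, R15a);
* §2 **`orbitSpan_sandwich_of_fullPlanes`** — the CANONICAL two-sided statement for a `ℤ_p`-region `M ⊆ c·L` whose plane contents are FULL (every
  plane-coordinate value of `c·L` is a plane-`i` coordinate of an element of `M`; automatic for regions in general position): every additive subgroup `N`
  containing the images of `M` under the five strip elements `1, ψ_i, ψ'_i, ψ'_iψ_i, ψ_iψ'_i` contains `M + c·W_v` (generators `c·y^*_{(i,0)}(z)·y_{(i,ε')}`,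
  `z ∈ L`), while (R17b §1, UNCONDITIONAL) the whole print-(Ind1)⊔(Ind2) orbit of `M` lies in `M + c·W_v`: **the additive span of the print orbit of `M` is EXACTLY
  `M + c·(log_p(𝒪_v^×) ∩ Ker Tr)`** for such `M` — print's (Ind1) strip part AS TYPED realises the trace-compatible part of the Dupuy–Hilado container's orbit span
  (`c·log_p(𝒪_v^×)`, abc-iut-w5-d180) EXACTLY, and Kondo's open base-line bit (does `Aut(G_k)` move `y_1`?) is immaterial.  What «full plane contents» leaves
  open (regions in special position relative to ONE plane) would be removed by the mapping-class-group image `Sp_{2g}(ℤ_p) ⊆ Φ(Out G_k)` (Kondo 2025 §3,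
  Thm 3.17 / Rem 3.18 — NOT a tree fact), which mixes the planes.
HONEST SCOPE: single place; conditional on `hJW : JannsenWingbergTwists` (binder); nothing here computes a tensor-packet hull or a log-volume; no side taken on
[IUTchIII] Cor. 3.12; NO abc claim. [claim: Mochizuki2012, status: disputed]; [cite: Kondo2025OuterAutMLF, §2 Thm 2.3 and proof p.10, §3 Rem 3.16–3.18];
[cite: JannsenWingberg1982, Thm 2 p.75, §5.1 p.96]; [cite: HoshiNishio2022OuterAutMLF, Lemma 1.3, Lemma 2.3 (ii)]; [cite: WeilBNT1967, Ch. II §2, Th. 1];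
[cite: DupuyHilado2025, §4.9]. typed ≠ proved; a conditional theorem discharges nothing it binds.
-/

set_option autoImplicit false

noncomputable section

open Metric Set
open scoped Pointwise

namespace Summit.ABC.IUTFork.Thm311.Real

open NumberField IsDedekindDomain Literature.NumberTheory.NumberFields Literature.IUT.LogVolume
open Literature.NumberTheory.GaloisRepresentations Literature.NumberTheory.GaloisRepresentations.Ultrametric
open Literature.AnabelianGeometry.AbsoluteAnabelian Literature.IUT.HodgeArakelov
open Literature.IUT.HodgeArakelov.AbsTopMonoids Literature.IUT.LogThetaLattice

variable {F : Type} [Field F] [NumberField F] (v : HeightOneSpectrum (𝓞 F))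

/-! ## 1. `log_p(𝒪_v^×)` is a box in the Jannsen–Wingberg basis -/

/-- **THE JANNSEN–WINGBERG LOG-BASIS IS A BOX BASIS OF `log_p(𝒪_v^×)` (modulo `JannsenWingbergTwists`), ODD local degree.**  At `v ∣ p` odd with
`d = [K_v : ℚ_p] ≥ 3` ODD: the data of R17b `exists_planes_smul_mem_of_orbit` (the `ℚ_p`-basis `y : Fin 1 ⊕ Fin g × Fin 2` of `K_v^{(1/n_v)}`, planes trace-zero and
spanning `Ker Tr`, `Tr(y_{inl 0}) ≠ 0`, the plane transvections `ψ_i, ψ'_i` realised in `Real.ind1StripOf v (galoisLog v)`, and the orbit-reach clause) TOGETHER WITH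
the integrality of the basis relative to `L = log_p(R^×)`: for every `z ∈ L`, `y^*_{(i,ε)}(z)·y_{(i,ε')} ∈ L` for all `i, ε, ε'` and `y^*_{inl 0}(z)·y_{inl 0} ∈ L` —
`L` is the BOX `y^*_{inl 0}(L)·y_{inl 0} ⊕ ⊕_i I_i·(ℤ_p y_{(i,0)} ⊕ ℤ_p y_{(i,1)})` with `I_i = y^*_{(i,0)}(L) = y^*_{(i,1)}(L)`.  (R17b §2 with `M = N = L`: the realised
transvections map `L` onto itself, R9/R17b §1.) [claim: Mochizuki2012, status: disputed] [cite: Kondo2025OuterAutMLF, §2 Thm 2.3 and proof p.10]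
[cite: JannsenWingberg1982, §5.1 p.96] [cite: WeilBNT1967, Ch. II §2, Th. 1] -/
theorem exists_boxBasis_logUnits_of_jannsenWingberg_odd (hJW : JannsenWingbergTwists)
    (p : ℕ) [Fact p.Prime] (hv : ((p : ℕ) : 𝓞 F) ∈ v.asIdeal) (hp2 : p ≠ 2) (h3 : 3 ≤ localDeg F v) (hodd : Odd (localDeg F v)) :
    ∃ (g : ℕ) (_ : localDeg F v = 1 + 2 * g) (y : Module.Basis (Fin 1 ⊕ Fin g × Fin 2) ℚ_[p] (RescaledCompletion F p v hv))
      (ψ ψ' : Fin g → (v.adicCompletion F ≃+ v.adicCompletion F)),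
      (∀ i, ψ i ∈ ind1StripOf v (galoisLog v)) ∧ (∀ i, ψ' i ∈ ind1StripOf v (galoisLog v)) ∧
      (∀ iε : Fin g × Fin 2, Algebra.trace ℚ_[p] (RescaledCompletion F p v hv) (y (Sum.inr iε)) = 0) ∧
      Submodule.span ℚ_[p] (Set.range fun iε : Fin g × Fin 2 => y (Sum.inr iε)) =
        LinearMap.ker (Algebra.trace ℚ_[p] (RescaledCompletion F p v hv)) ∧
      Algebra.trace ℚ_[p] (RescaledCompletion F p v hv) (y (Sum.inl 0)) ≠ 0 ∧
      (∀ (M : Set (v.adicCompletion F)) (N : AddSubgroup (RescaledCompletion F p v hv)),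
        (∀ x ∈ M, RescaledCompletion.of F p v hv x ∈ N) →
        (∀ i, ∀ x ∈ M, RescaledCompletion.of F p v hv (ψ i x) ∈ N ∧ RescaledCompletion.of F p v hv (ψ' i x) ∈ N ∧
          RescaledCompletion.of F p v hv (ψ' i (ψ i x)) ∈ N ∧ RescaledCompletion.of F p v hv (ψ i (ψ' i x)) ∈ N) →
        ∀ i, ∀ x ∈ M, ∀ ε ε' : Fin 2,
          y.coord (Sum.inr (i, ε)) (RescaledCompletion.of F p v hv x) • y (Sum.inr (i, ε')) ∈ N) ∧
      -- INTEGRALITY: `log_p(R^×)` is a box in the basis `y`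
      (∀ z ∈ logUnits (RescaledCompletion F p v hv), ∀ i, ∀ ε ε' : Fin 2,
          y.coord (Sum.inr (i, ε)) z • y (Sum.inr (i, ε')) ∈ logUnits (RescaledCompletion F p v hv)) ∧
      (∀ z ∈ logUnits (RescaledCompletion F p v hv),
          y.coord (Sum.inl 0) z • y (Sum.inl 0) ∈ logUnits (RescaledCompletion F p v hv)) ∧
      -- CANONICAL SANDWICH, lower half under FULL PLANE CONTENTS: the orbit span contains the generators of `c·W_v` …
      (∀ (c : ℚ_[p]) (M : Set (v.adicCompletion F)) (N : AddSubgroup (RescaledCompletion F p v hv)),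
        (∀ x ∈ M, RescaledCompletion.of F p v hv x ∈ N) →
        (∀ i, ∀ x ∈ M, RescaledCompletion.of F p v hv (ψ i x) ∈ N ∧ RescaledCompletion.of F p v hv (ψ' i x) ∈ N ∧
          RescaledCompletion.of F p v hv (ψ' i (ψ i x)) ∈ N ∧ RescaledCompletion.of F p v hv (ψ i (ψ' i x)) ∈ N) →
        (∀ i, ∀ z ∈ logUnits (RescaledCompletion F p v hv), ∃ x ∈ M, ∃ ε : Fin 2,
          y.coord (Sum.inr (i, ε)) (RescaledCompletion.of F p v hv x) = c * y.coord (Sum.inr (i, 0)) z) →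
        ∀ z ∈ logUnits (RescaledCompletion F p v hv), ∀ i, ∀ ε' : Fin 2,
          (c * y.coord (Sum.inr (i, 0)) z) • y (Sum.inr (i, ε')) ∈ N) ∧
      -- … these generators are trace-zero elements of `c·log_p(R^×)` …
      (∀ (c : ℚ_[p]), ∀ z ∈ logUnits (RescaledCompletion F p v hv), ∀ i, ∀ ε' : Fin 2,
          (c * y.coord (Sum.inr (i, 0)) z) • y (Sum.inr (i, ε')) ∈ c • logUnits (RescaledCompletion F p v hv) ∧
          Algebra.trace ℚ_[p] (RescaledCompletion F p v hv) ((c * y.coord (Sum.inr (i, 0)) z) • y (Sum.inr (i, ε'))) = 0) ∧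
      -- … and they additively generate ALL of `c·W_v = c·(log_p(R^×) ∩ Ker Tr)`
      (∀ (c : ℚ_[p]) (N : AddSubgroup (RescaledCompletion F p v hv)),
        (∀ z ∈ logUnits (RescaledCompletion F p v hv), ∀ i, ∀ ε' : Fin 2, (c * y.coord (Sum.inr (i, 0)) z) • y (Sum.inr (i, ε')) ∈ N) →
        ∀ z ∈ logUnits (RescaledCompletion F p v hv), Algebra.trace ℚ_[p] (RescaledCompletion F p v hv) z = 0 → c • z ∈ N) := by
  obtain ⟨g, hg, y, ψ, ψ', hψ, hψ', htr0, hspan, htr1, horb⟩ := exists_planes_smul_mem_of_orbit v hJW p hv hp2 h3 hodd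
  set e := RescaledCompletion.of F p v hv with he
  set R := RescaledCompletion F p v hv
  set LA : AddSubgroup R := logUnitsAddSubgroup p R with hLA
  have hLAL : ∀ z : R, z ∈ LA ↔ z ∈ logUnits R := fun z => Iff.rfl
  -- L-stability of the realised transvections (R17b §1 with `c = 1`)
  have hstab : ∀ {χ : v.adicCompletion F ≃+ v.adicCompletion F}, χ ∈ ind1StripOf v (galoisLog v) →
      ∀ x : v.adicCompletion F, e x ∈ logUnits R → e (χ x) ∈ logUnits R := by
    intro χ hχ x hx
    have hx1 : e x ∈ (1 : ℚ_[p]) • logUnits R := by rw [one_smul]; exact hx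
    have h := (sub_mem_smul_logUnits_inter_ker_trace_of_mem_ind1StripOf v p hv hχ 1 hx1).1
    rw [one_smul] at h
    have h' := LA.add_mem (show e (χ x) - e x ∈ LA from h) (show e x ∈ LA from hx)
    rwa [sub_add_cancel] at h'
  -- R17b §2 with `M = e⁻¹(L)`, `N = L`
  have hplanes : ∀ i, ∀ x ∈ {x : v.adicCompletion F | e x ∈ logUnits R}, ∀ ε ε' : Fin 2,
      y.coord (Sum.inr (i, ε)) (e x) • y (Sum.inr (i, ε')) ∈ LA :=
    horb {x | e x ∈ logUnits R} LA (fun x hx => hx) fun i x hx =>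
      ⟨hstab (hψ i) x hx, hstab (hψ' i) x hx, hstab (hψ' i) _ (hstab (hψ i) x hx), hstab (hψ i) _ (hstab (hψ' i) x hx)⟩
  have hbox : ∀ z ∈ logUnits R, ∀ i, ∀ ε ε' : Fin 2, y.coord (Sum.inr (i, ε)) z • y (Sum.inr (i, ε')) ∈ logUnits R := by
    intro z hz i ε ε'
    have h := hplanes i (e.symm z) (by show e (e.symm z) ∈ logUnits R; rw [e.apply_symm_apply]; exact hz) ε ε'
    rwa [e.apply_symm_apply] at h
  have hcoord : ∀ s t : Fin 1 ⊕ Fin g × Fin 2, y.coord s (y t) = if t = s then 1 else 0 := by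
    intro s t
    rw [Module.Basis.coord_apply, Module.Basis.repr_self, Finsupp.single_apply]
  have hres : ∀ z ∈ logUnits R, y.coord (Sum.inl 0) z • y (Sum.inl 0) ∈ logUnits R := by
    intro z hz
    -- the residual coordinate: `y^*_{inl 0}(z)·y_{inl 0} = z − Σ_planes`
    have hsum : y.coord (Sum.inl 0) z • y (Sum.inl 0) =
        z - ∑ iε : Fin g × Fin 2, y.coord (Sum.inr iε) z • y (Sum.inr iε) := by
      have h := y.sum_repr z
      rw [Fintype.sum_sum_type, Fin.sum_univ_one] at h
      rw [eq_sub_iff_add_eq]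
      simpa only [Module.Basis.coord_apply] using h
    rw [hsum]
    refine LA.sub_mem (show z ∈ LA from hz) (LA.sum_mem fun iε _ => ?_)
    obtain ⟨i, ε⟩ := iε
    exact hbox z hz i ε ε
  -- the swap: `y^*_{(i,1)}(z)` is the `(i,0)`-coordinate of the box element `y^*_{(i,1)}(z)·y_{(i,0)} ∈ L`
  have hswap : ∀ z ∈ logUnits R, ∀ i,
      y.coord (Sum.inr (i, 1)) z • y (Sum.inr (i, 0)) ∈ logUnits R ∧
        y.coord (Sum.inr (i, 0)) (y.coord (Sum.inr (i, 1)) z • y (Sum.inr (i, 0))) = y.coord (Sum.inr (i, 1)) z := by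
    intro z hz i
    refine ⟨hbox z hz i 1 0, ?_⟩
    rw [map_smul, hcoord, if_pos rfl, smul_eq_mul, mul_one]
  refine ⟨g, hg, y, ψ, ψ', hψ, hψ', htr0, hspan, htr1, horb, hbox, hres, ?_, ?_, ?_⟩
  · -- lower half under full plane contents
    intro c M N hMN horbN hfull z hz i ε'
    obtain ⟨x, hxM, ε, hε⟩ := hfull i z hz
    have h := horb M N hMN horbN i x hxM ε ε'
    rwa [hε] at h
  · -- the generators lie in `c·L ∩ Ker Tr`
    intro c z hz i ε'
    refine ⟨?_, ?_⟩
    · rw [mul_smul]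
      exact Set.smul_mem_smul_set (hbox z hz i 0 ε')
    · rw [map_smul, htr0, smul_zero]
  · -- they generate `c·W_v`
    intro c N hN z hz htz
    haveI : FiniteDimensional ℚ_[p] R := FiniteDimensional.of_locallyCompactSpace ℚ_[p]
    -- `z ∈ Ker Tr = span(planes)` has residual coordinate `0`
    have hzspan : z ∈ Submodule.span ℚ_[p] (Set.range fun iε : Fin g × Fin 2 => y (Sum.inr iε)) := by
      rw [hspan]; exact htz
    have hz0 : y.repr z (Sum.inl 0) = 0 := by
      have hrange : (Set.range fun iε : Fin g × Fin 2 => y (Sum.inr iε)) = y '' Set.range (Sum.inr : Fin g × Fin 2 → _) := by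
        ext w; simp
      rw [hrange, Module.Basis.mem_span_image] at hzspan
      by_contra hne
      have hmem : (Sum.inl 0 : Fin 1 ⊕ Fin g × Fin 2) ∈ ((y.repr z).support : Set (Fin 1 ⊕ Fin g × Fin 2)) := by
        rw [Finset.mem_coe, Finsupp.mem_support_iff]; exact hne
      obtain ⟨j, hj⟩ := hzspan hmem
      exact Sum.inr_ne_inl hj
    -- `c • z = Σ_{i,ε'} (c * y^*_{(i,ε')}(z)) • y_{(i,ε')}`
    have hsum : c • z = ∑ iε : Fin g × Fin 2, (c * y.coord (Sum.inr iε) z) • y (Sum.inr iε) := by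
      have h := y.sum_repr z
      rw [Fintype.sum_sum_type, Fin.sum_univ_one, hz0, zero_smul, zero_add] at h
      conv_lhs => rw [← h]
      rw [Finset.smul_sum]
      refine Finset.sum_congr rfl fun iε _ => ?_
      rw [mul_smul, Module.Basis.coord_apply]
    rw [hsum]
    refine N.sum_mem fun iε _ => ?_
    obtain ⟨i, ε'⟩ := iε
    fin_cases ε'
    · exact hN z hz i 0
    · -- `c * y^*_{(i,1)}(z) • y_{(i,1)}` is the generator attached to the box element `y^*_{(i,1)}(z)·y_{(i,0)}`
      obtain ⟨hz', hc'⟩ := hswap z hz i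
      have h := hN _ hz' i 1
      rw [hc'] at h
      exact h

end Summit.ABC.IUTFork.Thm311.Real

end
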